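import Literature.Analysis.FluidPDE.FluidComputer.ShellTransferParseval
import Literature.Analysis.FluidPDE.FluidComputer.GalerkinEnergyBalance
import Literature.Analysis.FluidPDE.FluidComputer.ClassicalLatticeData

/-!
# Parseval for the energy, the enstrophy and the helicity of a truncated Fourier field: the physical-space `E = ½⟨|u|²⟩`, `Z = ½⟨|∇u|²⟩ = ½⟨|ω|²⟩`, `H = ⟨u·ω⟩` equal the spectral sums

HONEST FRAMING (cell `pub-fluidc`, verbatim): *low prior, high value-of-information experiment on
Tao's machine paradigm; NOT a claim that NS blows up.* Nothing here concerns the Navier–Stokes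
evolution. For a real, incompressible field of Fourier coefficients `û` (`ShellTransfer.FourierVelocity`)
and a finite mode set `S` closed under `k ↦ -k` (the mode set of a dealiased pseudo-spectral code is),
the physical fields are the trigonometric polynomials `u_j = Σ_{k∈S} û_j(k) e^{ik·x}`
(`ShellTransfer.field`, from ShellTransferParseval). PROVED:

* `conj_field` / `field_im_eq_zero`: `u_j` is REAL-valued (reality of `û` + symmetry of `S`);
* `cellIntegralC_fieldSq`: `∫∫∫_cell Σ_j u_j² = (2π)³ Σ_{k∈S} Σ_j |û_j(k)|²`, i.e.
  **`½⟨|u|²⟩ = ½ Σ_{k∈S} |û(k)|² = truncEnergy û S`** (`truncEnergy_eq_cellMean`, and in the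
  real-field vocabulary of ClassicalLatticeData `cellEnergy (Re u₀) (Re u₁) (Re u₂) = truncEnergy û S`,
  `cellEnergy_field_eq_truncEnergy`) [folklore: Parseval/Plancherel on `𝕋³` for trigonometric
  polynomials; normalisation `E = ½⟨|u|²⟩` as in [cite: VanReesEtAl2011VortexSpectral, §3.1] and
  [cite: DoeringGibbon1995, §5.3 (5.3.18)]];
* `cellIntegralC_dfieldSq`: `∫∫∫ Σ_{l,j} (∂_l u_j)² = (2π)³ Σ_{k∈S} |k|² Σ_j |û_j(k)|²`, i.e.
  **`½⟨|∇u|²⟩ = ½ Σ |k|²|û(k)|² = truncEnstrophy û S`** (`truncEnstrophy_eq_cellMean`, v2) [folklore].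

So the `E_S`, `Z_S` of GalerkinEnergyBalance (whose exact budget `dE_S/dt = -2νZ_S + ε_in` is
proved there) ARE the cell-averaged energy and gradient-enstrophy a code prints, for the truncated
field it holds. Every integral is an iterated interval integral of a finite sum of plane waves,
computed in closed form (`cellIntegralC_sum_wave`). No named facts (D-0026).

v2 (literature seat gen 15, append-only) — THE VORTICITY FORM, i.e. the finite-mode-set case of
`⟨|∇u|²⟩ = ⟨|ω|²⟩` for divergence-free fields on `𝕋³` [folklore]:

* `kcross`, `curl` (the vorticity coefficient field `ω̂(k) = ik × û(k)`, again a `FourierVelocity`: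
  reality and `k·ω̂ = 0` proved), `normSq_kcross_sum` (Lagrange's identity with `k·û = 0`:
  `Σ_j|(k × û)_j|² = |k|²|û|²`), `modalEnergy_curl`, **`truncEnergy_curl`: `E_S(curl û) = Z_S(û)`**;
* `field_curl_zero/one/two` (`ω_S = ∇ × u_S` componentwise through `dfield`),
  `hasDerivAt_field_re_x/y/z`, `vorticity₁/₂/₃_field_re` (ClassicalLatticeData's coordinate-line
  `vorticityⱼ` of the real fields `Re u_j` is `Re ω_{S,j}`);
* **`cellEnstrophy_field_eq_truncEnstrophy`: `ClassicalLatticeData.cellEnstrophy (Re u) = ½⟨|ω|²⟩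
  = truncEnstrophy û S`** and `cellEnstrophy_field_eq_half_mean_gradSq` (`½⟨|ω|²⟩ = ½⟨|∇u|²⟩`),
  plus `truncEnstrophy_eq_cellMean` (the name v1's summary used for `cellIntegralC_dfieldSq`, now a
  theorem). Incompressibility is essential here (a gradient mode has `ω̂ = 0`, `|k|²|û|² ≠ 0`).

With v2 the typed chain datum → `E(0)`, `Z(0)` (cell averages through the vorticity, as the numbers
`1/8, 3/8` / `3/8, 33/8` of ClassicalLatticeData are computed) → spectral `E_S`, `Z_S` → exact
truncated budget is closed for BOTH quadratic invariants a pseudo-spectral code reports.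

v3 (literature seat gen 15, append-only) — THE HELICITY and the spectral realizability bound
[folklore]:

* `cellIntegralC_fieldMul` (bilinear Parseval `∫∫∫ Σ_j u_j v_j = (2π)³ Σ_{k∈S} Σ_j û_j(k) conj v̂_j(k)`
  for two truncated real fields on one symmetric mode set), `modalHelicity` (`H(k) = Re(û·conj ω̂)`),
  `truncHelicity`, `modalHelicity_neg` (`H(-k) = H(k)`);
* **`cellHelicity_field_eq_truncHelicity`: `ClassicalLatticeData.cellHelicity (Re u) = ⟨u·ω⟩ =
  truncHelicity û S`** — the third datum number (`H(0) = 0` TG/KP; `H = 2E` for the ABC datum of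
  ABCFlowData) is the spectral helicity;
* **`abs_modalHelicity_le`: `|H(k)| ≤ 2|k| E(k)`** (Cauchy–Schwarz with `|ω̂(k)| = |k||û(k)|`), and
  `abs_truncHelicity_le`; Beltrami modes (`ω̂ = ±|k|û`, every ABC mode) attain the bound.

v4 (literature seat gen 17, append-only) — THE INTEGRATED SCHWARZ BOUND [cite: Lesieur1990, Ch. V §6
(V-6-11)–(V-6-13)] (there `|H(k)|/k < E(k)` for the helicity spectrum of `½⟨u·(∇×u)⟩`, i.e. the present
`|H(k)| ≤ 2|k|E(k)` for `⟨u·ω⟩`; the integrated form is the Schwarz inequality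
`|⟨u·ω⟩| ≤ ⟨|u|²⟩^{1/2}⟨|ω|²⟩^{1/2}` [folklore]):

* **`abs_truncHelicity_le_sqrt`: `|H_S| ≤ 2 √E_S √Z_S`** for every coefficient field and every finite
  mode set (`truncHelicity_sq_le`: `H_S² ≤ 4 E_S Z_S`); on a mask with `|k|² ≤ K²` also
  `|H_S| ≤ 2K E_S` (`abs_truncHelicity_le_of_knormSq_le`);
* **`abs_cellHelicity_field_le`**: the same bound for the cell averages of the real truncated fields,
  `|cellHelicity| ≤ 2 √cellEnergy √cellEnstrophy` (through the three Parseval identities above) — the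
  row-level realizability check `|H| ≤ 2√(E·Z)` for every diag row of either engine that carries `H`,
  and the statement that the relative helicity `H/(2√(EZ))` a code prints lies in `[-1, 1]`.
-/

noncomputable section

namespace Literature.Analysis.FluidPDE.FluidComputer

open Complex ComplexConjugate Finset Real intervalIntegral
open scoped BigOperators

namespace ShellTransfer

variable (U : FourierVelocity)

/-! ## Reality of the physical field -/

/-- `conj e_n(t) = e_{-n}(t)`. [folklore] -/
theorem conj_mode (n : ℤ) (t : ℝ) : conj (mode n t) = mode (-n) t := by
  unfold mode
  rw [← Complex.exp_conj]
  congr 1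
  simp only [map_mul, Complex.conj_I, Complex.conj_ofReal, map_intCast, Int.cast_neg]
  ring

/-- `conj e^{ik·x} = e^{i(-k)·x}`. [folklore] -/
theorem conj_wave (m : Fin 3 → ℤ) (x y z : ℝ) : conj (wave m x y z) = wave (-m) x y z := by
  unfold wave
  rw [map_mul, map_mul, conj_mode, conj_mode, conj_mode]
  rfl

/-- **The physical field of a real coefficient field on a symmetric mode set is real**:
`conj u_j(x) = u_j(x)`. [folklore] -/
theorem conj_field (S : Finset (Fin 3 → ℤ)) (hK : ∀ k ∈ S, -k ∈ S) (j : Fin 3) (x y z : ℝ) :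
    conj (field U S j x y z) = field U S j x y z := by
  unfold field
  rw [map_sum]
  -- conj(û_j(k) e^{ik·x}) = û_j(-k) e^{i(-k)·x}; then re-index k ↦ -k over the symmetric set S
  have h : ∀ k, conj (U.coeff k j * wave k x y z) = U.coeff (-k) j * wave (-k) x y z := by
    intro k
    rw [map_mul, conj_wave, U.reality]
  simp_rw [h]
  exact Finset.sum_nbij' (fun k => -k) (fun k => -k) hK hK (fun k _ => neg_neg k)
    (fun k _ => neg_neg k) (fun k _ => rfl)

/-- Hence `Im u_j(x) = 0`. [folklore] -/
theorem field_im_eq_zero (S : Finset (Fin 3 → ℤ)) (hK : ∀ k ∈ S, -k ∈ S) (j : Fin 3) (x y z : ℝ) :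
    (field U S j x y z).im = 0 :=
  Complex.conj_eq_iff_im.mp (conj_field U S hK j x y z)

/-- and `u_j(x) = Re u_j(x)` as a complex number. [folklore] -/
theorem field_eq_ofReal_re (S : Finset (Fin 3 → ℤ)) (hK : ∀ k ∈ S, -k ∈ S) (j : Fin 3) (x y z : ℝ) :
    field U S j x y z = (((field U S j x y z).re : ℝ) : ℂ) :=
  (Complex.conj_eq_iff_re.mp (conj_field U S hK j x y z)).symm

/-! ## Parseval for the energy -/

/-- `Σ_j u_j u_j` as one finite sum of plane waves over `(j,k,p) ∈ Fin 3 × S × S`. [folklore] -/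
theorem fieldSq_expand (S : Finset (Fin 3 → ℤ)) (x y z : ℝ) :
    ∑ j, field U S j x y z * field U S j x y z =
      ∑ t ∈ (Finset.univ : Finset (Fin 3)) ×ˢ (S ×ˢ S),
        (U.coeff t.2.1 t.1 * U.coeff t.2.2 t.1) * wave (t.2.1 + t.2.2) x y z := by
  rw [Finset.sum_product]
  refine Finset.sum_congr rfl fun j _ => ?_
  unfold field
  rw [Finset.sum_mul_sum, Finset.sum_product]
  refine Finset.sum_congr rfl fun k _ => Finset.sum_congr rfl fun p _ => ?_
  rw [wave_add]; ring

/-- `∫∫∫ Σ_j u_j² = Σ_j Σ_{k,p∈S} [k+p=0] (2π)³ û_j(k) û_j(p)`. [folklore] -/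
theorem cellIntegralC_fieldSq_sum (S : Finset (Fin 3 → ℤ)) :
    cellIntegralC (fun x y z => ∑ j, field U S j x y z * field U S j x y z) =
      ∑ j, ∑ k ∈ S, ∑ p ∈ S,
        if k + p = 0 then U.coeff k j * U.coeff p j * (2 * π : ℂ) ^ 3 else 0 := by
  have e : (fun x y z => ∑ j, field U S j x y z * field U S j x y z) = fun x y z =>
      ∑ t ∈ (Finset.univ : Finset (Fin 3)) ×ˢ (S ×ˢ S),
        (U.coeff t.2.1 t.1 * U.coeff t.2.2 t.1) * wave (t.2.1 + t.2.2) x y z := by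
    funext x y z; exact fieldSq_expand U S x y z
  rw [e, cellIntegralC_sum_wave]
  simp_rw [modeIntegral_prod_eq]
  rw [Finset.sum_product]
  refine Finset.sum_congr rfl fun j _ => ?_
  rw [Finset.sum_product]
  refine Finset.sum_congr rfl fun k _ => Finset.sum_congr rfl fun p _ => ?_
  split_ifs <;> simp

/-- The closed pairs: `Σ_{p∈S} [k+p=0] (2π)³ û_j(k) û_j(p) = (2π)³ |û_j(k)|²` for `k ∈ S`, `S = -S`
(reality `û(-k) = conj û(k)`). [folklore] -/
theorem sum_closedPair (S : Finset (Fin 3 → ℤ)) (hK : ∀ k ∈ S, -k ∈ S) (j : Fin 3)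
    {k : Fin 3 → ℤ} (hk : k ∈ S) :
    (∑ p ∈ S, if k + p = 0 then U.coeff k j * U.coeff p j * (2 * π : ℂ) ^ 3 else 0) =
      (2 * π : ℂ) ^ 3 * ((Complex.normSq (U.coeff k j) : ℝ) : ℂ) := by
  have hiff : ∀ p : Fin 3 → ℤ, (k + p = 0) = (-k = p) := fun p =>
    propext neg_eq_iff_add_eq_zero.symm
  simp_rw [hiff]
  rw [Finset.sum_ite_eq S (-k), if_pos (hK k hk), U.reality, Complex.mul_conj]
  ring

/-- **Parseval for the energy**: `∫∫∫_cell Σ_j u_j² = (2π)³ · 2 E_S`, `E_S = ½Σ_{k∈S}|û(k)|²`. [folklore] -/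
theorem cellIntegralC_fieldSq (S : Finset (Fin 3 → ℤ)) (hK : ∀ k ∈ S, -k ∈ S) :
    cellIntegralC (fun x y z => ∑ j, field U S j x y z * field U S j x y z) =
      (2 * π : ℂ) ^ 3 * (((2 * truncEnergy U S : ℝ)) : ℂ) := by
  rw [cellIntegralC_fieldSq_sum]
  have h : ∀ j, ∑ k ∈ S, (∑ p ∈ S, if k + p = 0 then U.coeff k j * U.coeff p j * (2 * π : ℂ) ^ 3 else 0) =
      ∑ k ∈ S, (2 * π : ℂ) ^ 3 * ((Complex.normSq (U.coeff k j) : ℝ) : ℂ) := fun j =>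
    Finset.sum_congr rfl fun k hk => sum_closedPair U S hK j hk
  simp_rw [h]
  have htr : 2 * truncEnergy U S = ∑ k ∈ S, ∑ j, Complex.normSq (U.coeff k j) := by
    unfold truncEnergy modalEnergy
    rw [Finset.mul_sum]
    refine Finset.sum_congr rfl fun k _ => ?_
    ring
  rw [htr, Finset.sum_comm]
  push_cast
  rw [Finset.mul_sum]
  refine Finset.sum_congr rfl fun k _ => ?_
  rw [Finset.mul_sum]

/-- `E_S = (2π)⁻³ Re ∫∫∫ ½ Σ_j u_j²` — the truncated energy IS the cell-mean kinetic energy. [folklore] -/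
theorem truncEnergy_eq_cellMean (S : Finset (Fin 3 → ℤ)) (hK : ∀ k ∈ S, -k ∈ S) :
    truncEnergy U S =
      (cellIntegralC (fun x y z => ∑ j, field U S j x y z * field U S j x y z)).re / (2 * π) ^ 3 / 2 := by
  rw [cellIntegralC_fieldSq U S hK]
  have hre : ((2 * π : ℂ) ^ 3 * (((2 * truncEnergy U S : ℝ)) : ℂ)).re = (2 * π) ^ 3 * (2 * truncEnergy U S) := by
    have : (2 * π : ℂ) ^ 3 * (((2 * truncEnergy U S : ℝ)) : ℂ) = (((2 * π) ^ 3 * (2 * truncEnergy U S) : ℝ) : ℂ) := by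
      push_cast; ring
    rw [this, Complex.ofReal_re]
  rw [hre]
  have hpi : (2 * π) ^ 3 ≠ 0 := by positivity
  field_simp

/-! ## The same statement in the real-field vocabulary of ClassicalLatticeData -/

/-- A complex cell integral of a real-valued integrand is the real cell integral. [folklore] -/
theorem cellIntegralC_ofReal (g : ℝ → ℝ → ℝ → ℝ) :
    cellIntegralC (fun x y z => ((g x y z : ℝ) : ℂ)) = ((cellIntegral g : ℝ) : ℂ) := by
  unfold cellIntegralC cellIntegral
  simp_rw [intervalIntegral.integral_ofReal]

/-- **`cellEnergy` of the real fields `Re u_j` equals `truncEnergy`**: `½⟨u² + v² + w²⟩ = ½Σ_{k∈S}|û(k)|²`.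
[folklore] -/
theorem cellEnergy_field_eq_truncEnergy (S : Finset (Fin 3 → ℤ)) (hK : ∀ k ∈ S, -k ∈ S) :
    cellEnergy (fun x y z => (field U S 0 x y z).re) (fun x y z => (field U S 1 x y z).re)
      (fun x y z => (field U S 2 x y z).re) = truncEnergy U S := by
  unfold cellEnergy cellMean
  have hint : cellIntegral (fun x y z => (field U S 0 x y z).re ^ 2 + (field U S 1 x y z).re ^ 2 +
      (field U S 2 x y z).re ^ 2) = (2 * π) ^ 3 * (2 * truncEnergy U S) := by
    have hC := cellIntegralC_fieldSq U S hK
    have e : (fun x y z => ∑ j, field U S j x y z * field U S j x y z) = fun x y z =>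
        ((((field U S 0 x y z).re ^ 2 + (field U S 1 x y z).re ^ 2 + (field U S 2 x y z).re ^ 2 : ℝ)) : ℂ) := by
      funext x y z
      rw [Fin.sum_univ_three, field_eq_ofReal_re U S hK 0, field_eq_ofReal_re U S hK 1,
        field_eq_ofReal_re U S hK 2]
      push_cast
      simp only [Complex.ofReal_re]
      ring
    rw [e, cellIntegralC_ofReal] at hC
    have hC' := congrArg Complex.re hC
    have h2 : ((2 * π : ℂ) ^ 3 * (((2 * truncEnergy U S : ℝ)) : ℂ)).re = (2 * π) ^ 3 * (2 * truncEnergy U S) := by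
      have : (2 * π : ℂ) ^ 3 * (((2 * truncEnergy U S : ℝ)) : ℂ) = (((2 * π) ^ 3 * (2 * truncEnergy U S) : ℝ) : ℂ) := by
        push_cast; ring
      rw [this, Complex.ofReal_re]
    rw [Complex.ofReal_re, h2] at hC'
    exact hC'
  rw [hint]
  have hpi : (2 * π) ^ 3 ≠ 0 := by positivity
  field_simp

/-! ## Parseval for the enstrophy (gradient form) -/

/-- `Σ_{l,j} (∂_l u_j)(∂_l u_j)` as one finite sum of plane waves. [folklore] -/
theorem dfieldSq_expand (S : Finset (Fin 3 → ℤ)) (x y z : ℝ) :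
    ∑ l, ∑ j, dfield U S l j x y z * dfield U S l j x y z =
      ∑ t ∈ ((Finset.univ : Finset (Fin 3)) ×ˢ (Finset.univ : Finset (Fin 3))) ×ˢ (S ×ˢ S),
        (I * ((t.2.1 t.1.1 : ℤ) : ℂ) * U.coeff t.2.1 t.1.2 * (I * ((t.2.2 t.1.1 : ℤ) : ℂ) * U.coeff t.2.2 t.1.2)) *
          wave (t.2.1 + t.2.2) x y z := by
  rw [Finset.sum_product, Finset.sum_product]
  refine Finset.sum_congr rfl fun l _ => Finset.sum_congr rfl fun j _ => ?_
  unfold dfield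
  rw [Finset.sum_mul_sum, Finset.sum_product]
  refine Finset.sum_congr rfl fun k _ => Finset.sum_congr rfl fun p _ => ?_
  rw [wave_add]; ring

/-- `∫∫∫ Σ_{l,j} (∂_l u_j)² = Σ_{l,j} Σ_{k,p∈S} [k+p=0] (2π)³ (ik_l û_j(k))(ip_l û_j(p))`. [folklore] -/
theorem cellIntegralC_dfieldSq_sum (S : Finset (Fin 3 → ℤ)) :
    cellIntegralC (fun x y z => ∑ l, ∑ j, dfield U S l j x y z * dfield U S l j x y z) =
      ∑ l, ∑ j, ∑ k ∈ S, ∑ p ∈ S,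
        if k + p = 0 then
          I * ((k l : ℤ) : ℂ) * U.coeff k j * (I * ((p l : ℤ) : ℂ) * U.coeff p j) * (2 * π : ℂ) ^ 3
        else 0 := by
  have e : (fun x y z => ∑ l, ∑ j, dfield U S l j x y z * dfield U S l j x y z) = fun x y z =>
      ∑ t ∈ ((Finset.univ : Finset (Fin 3)) ×ˢ (Finset.univ : Finset (Fin 3))) ×ˢ (S ×ˢ S),
        (I * ((t.2.1 t.1.1 : ℤ) : ℂ) * U.coeff t.2.1 t.1.2 * (I * ((t.2.2 t.1.1 : ℤ) : ℂ) * U.coeff t.2.2 t.1.2)) *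
          wave (t.2.1 + t.2.2) x y z := by
    funext x y z; exact dfieldSq_expand U S x y z
  rw [e, cellIntegralC_sum_wave]
  simp_rw [modeIntegral_prod_eq]
  rw [Finset.sum_product, Finset.sum_product]
  refine Finset.sum_congr rfl fun l _ => Finset.sum_congr rfl fun j _ => ?_
  rw [Finset.sum_product]
  refine Finset.sum_congr rfl fun k _ => Finset.sum_congr rfl fun p _ => ?_
  split_ifs <;> simp

/-- Closed pairs for the gradient: `Σ_{p∈S}[k+p=0](2π)³(ik_l û_j(k))(ip_l û_j(p)) = (2π)³ k_l² |û_j(k)|²`.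
[folklore] -/
theorem sum_closedPair_grad (S : Finset (Fin 3 → ℤ)) (hK : ∀ k ∈ S, -k ∈ S) (l j : Fin 3)
    {k : Fin 3 → ℤ} (hk : k ∈ S) :
    (∑ p ∈ S, if k + p = 0 then
        I * ((k l : ℤ) : ℂ) * U.coeff k j * (I * ((p l : ℤ) : ℂ) * U.coeff p j) * (2 * π : ℂ) ^ 3 else 0) =
      (2 * π : ℂ) ^ 3 * ((((k l : ℤ) : ℝ) ^ 2 * Complex.normSq (U.coeff k j) : ℝ) : ℂ) := by
  have hiff : ∀ p : Fin 3 → ℤ, (k + p = 0) = (-k = p) := fun p =>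
    propext neg_eq_iff_add_eq_zero.symm
  simp_rw [hiff]
  rw [Finset.sum_ite_eq S (-k), if_pos (hK k hk), U.reality]
  have hI : I * ((k l : ℤ) : ℂ) * U.coeff k j * (I * (((-k) l : ℤ) : ℂ) * conj (U.coeff k j)) =
      ((k l : ℤ) : ℂ) ^ 2 * (U.coeff k j * conj (U.coeff k j)) := by
    rw [Pi.neg_apply]; push_cast
    have : I * I = -1 := Complex.I_mul_I
    linear_combination (-(((k l : ℤ) : ℂ) ^ 2 * (U.coeff k j * conj (U.coeff k j)))) * this
  rw [hI, Complex.mul_conj]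
  push_cast; ring

/-- **Parseval for the enstrophy (gradient form)**: `∫∫∫ Σ_{l,j}(∂_l u_j)² = (2π)³ · 2 Z_S`,
`Z_S = ½ Σ_{k∈S} |k|²|û(k)|²`. [folklore] -/
theorem cellIntegralC_dfieldSq (S : Finset (Fin 3 → ℤ)) (hK : ∀ k ∈ S, -k ∈ S) :
    cellIntegralC (fun x y z => ∑ l, ∑ j, dfield U S l j x y z * dfield U S l j x y z) =
      (2 * π : ℂ) ^ 3 * (((2 * truncEnstrophy U S : ℝ)) : ℂ) := by
  rw [cellIntegralC_dfieldSq_sum]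
  have h : ∀ l j, ∑ k ∈ S, (∑ p ∈ S, if k + p = 0 then
      I * ((k l : ℤ) : ℂ) * U.coeff k j * (I * ((p l : ℤ) : ℂ) * U.coeff p j) * (2 * π : ℂ) ^ 3 else 0) =
      ∑ k ∈ S, (2 * π : ℂ) ^ 3 * ((((k l : ℤ) : ℝ) ^ 2 * Complex.normSq (U.coeff k j) : ℝ) : ℂ) :=
    fun l j => Finset.sum_congr rfl fun k hk => sum_closedPair_grad U S hK l j hk
  simp_rw [h]
  -- Σ_l Σ_j Σ_k (2π)³ k_l² |û_j(k)|² = (2π)³ · Σ_k |k|² Σ_j |û_j(k)|² : reorder to (k, l, j)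
  have reorder : ∑ l : Fin 3, ∑ j : Fin 3, ∑ k ∈ S,
      (2 * π : ℂ) ^ 3 * (((((k l : ℤ) : ℝ) ^ 2 * Complex.normSq (U.coeff k j)) : ℝ) : ℂ) =
      ∑ k ∈ S, ∑ l : Fin 3, ∑ j : Fin 3,
        (2 * π : ℂ) ^ 3 * (((((k l : ℤ) : ℝ) ^ 2 * Complex.normSq (U.coeff k j)) : ℝ) : ℂ) := by
    calc ∑ l : Fin 3, ∑ j : Fin 3, ∑ k ∈ S,
          (2 * π : ℂ) ^ 3 * (((((k l : ℤ) : ℝ) ^ 2 * Complex.normSq (U.coeff k j)) : ℝ) : ℂ)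
        = ∑ l : Fin 3, ∑ k ∈ S, ∑ j : Fin 3,
          (2 * π : ℂ) ^ 3 * (((((k l : ℤ) : ℝ) ^ 2 * Complex.normSq (U.coeff k j)) : ℝ) : ℂ) :=
          Finset.sum_congr rfl fun l _ => Finset.sum_comm
      _ = _ := Finset.sum_comm
  have htr : 2 * truncEnstrophy U S =
      ∑ k ∈ S, ∑ l : Fin 3, ∑ j : Fin 3, ((k l : ℤ) : ℝ) ^ 2 * Complex.normSq (U.coeff k j) := by
    unfold truncEnstrophy modalEnergy knormSq
    rw [Finset.mul_sum]
    refine Finset.sum_congr rfl fun k _ => ?_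
    rw [← Finset.sum_mul_sum]
    ring
  rw [reorder, htr]
  push_cast
  rw [Finset.mul_sum]
  refine Finset.sum_congr rfl fun k _ => ?_
  rw [Finset.mul_sum]
  refine Finset.sum_congr rfl fun l _ => ?_
  rw [Finset.mul_sum]

/-- `Z_S = (2π)⁻³ Re ∫∫∫ ½ Σ_{l,j} (∂_l u_j)²` — the truncated enstrophy IS the cell-mean of half the
squared velocity gradient. [folklore] -/
theorem truncEnstrophy_eq_cellMean (S : Finset (Fin 3 → ℤ)) (hK : ∀ k ∈ S, -k ∈ S) :
    truncEnstrophy U S =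
      (cellIntegralC (fun x y z => ∑ l, ∑ j, dfield U S l j x y z * dfield U S l j x y z)).re /
        (2 * π) ^ 3 / 2 := by
  rw [cellIntegralC_dfieldSq U S hK]
  have hre : ((2 * π : ℂ) ^ 3 * (((2 * truncEnstrophy U S : ℝ)) : ℂ)).re =
      (2 * π) ^ 3 * (2 * truncEnstrophy U S) := by
    have : (2 * π : ℂ) ^ 3 * (((2 * truncEnstrophy U S : ℝ)) : ℂ) =
        (((2 * π) ^ 3 * (2 * truncEnstrophy U S) : ℝ) : ℂ) := by
      push_cast; ring
    rw [this, Complex.ofReal_re]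
  rw [hre]
  have hpi : (2 * π) ^ 3 ≠ 0 := by positivity
  field_simp

/-! ## Parseval for the enstrophy, VORTICITY form: `½⟨|ω|²⟩ = Z_S` (so `⟨|ω|²⟩ = ⟨|∇u|²⟩`)

`ClassicalLatticeData.cellEnstrophy` — the quantity behind the datum numbers `Z(0) = 3/8`
(Taylor–Green) and `33/8` (Kida–Pelz) of that file — is `½⟨|ω|²⟩` with `ω = ∇ × u` taken by
coordinate-line derivatives, whereas the `Z_S` of the Galerkin budget (GalerkinEnergyBalance) is
`½ Σ_{k∈S} |k|²|û(k)|² = ½⟨|∇u|²⟩` (above). For a truncated real INCOMPRESSIBLE field the two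
coincide: in Fourier space `ω̂(k) = i k × û(k)`, and Lagrange's identity
`|k × û(k)|² = |k|²|û(k)|² − |k·û(k)|²` loses its last term to `k·û(k) = 0`. This is the
finite-mode-set case of the textbook identity `⟨|∇u|²⟩ = ⟨|ω|²⟩` for divergence-free fields on
`𝕋³` [folklore; e.g. DoeringGibbon1995 §2.1, Frisch 1995 §2.2]; incompressibility is essential
(for `û(k) ∥ k` one has `ω̂(k) = 0` but `|k|²|û(k)|² ≠ 0`). -/

/-- `k × a` for a wavevector `k ∈ ℤ³` and `a ∈ ℂ³`. [folklore] -/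
def kcross (k : Fin 3 → ℤ) (a : Fin 3 → ℂ) : Fin 3 → ℂ :=
  ![((k 1 : ℤ) : ℂ) * a 2 - ((k 2 : ℤ) : ℂ) * a 1,
    ((k 2 : ℤ) : ℂ) * a 0 - ((k 0 : ℤ) : ℂ) * a 2,
    ((k 0 : ℤ) : ℂ) * a 1 - ((k 1 : ℤ) : ℂ) * a 0]

/-- `(k × a)_0 = k_1 a_2 - k_2 a_1`. [folklore] -/
@[simp] theorem kcross_zero (k : Fin 3 → ℤ) (a : Fin 3 → ℂ) :
    kcross k a 0 = ((k 1 : ℤ) : ℂ) * a 2 - ((k 2 : ℤ) : ℂ) * a 1 := rfl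

/-- `(k × a)_1 = k_2 a_0 - k_0 a_2`. [folklore] -/
@[simp] theorem kcross_one (k : Fin 3 → ℤ) (a : Fin 3 → ℂ) :
    kcross k a 1 = ((k 2 : ℤ) : ℂ) * a 0 - ((k 0 : ℤ) : ℂ) * a 2 := rfl

/-- `(k × a)_2 = k_0 a_1 - k_1 a_0`. [folklore] -/
@[simp] theorem kcross_two (k : Fin 3 → ℤ) (a : Fin 3 → ℂ) :
    kcross k a 2 = ((k 0 : ℤ) : ℂ) * a 1 - ((k 1 : ℤ) : ℂ) * a 0 := rfl

/-- `k · (k × a) = 0`. [folklore] -/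
theorem kdot_kcross (k : Fin 3 → ℤ) (a : Fin 3 → ℂ) : kdot k (kcross k a) = 0 := by
  unfold kdot
  rw [Fin.sum_univ_three, kcross_zero, kcross_one, kcross_two]
  ring

/-- `(-k) × (conj a) = -conj (k × a)` componentwise (so `ω̂ = ik × û` inherits reality from `û`).
[folklore] -/
theorem kcross_neg_conj (k : Fin 3 → ℤ) (a : Fin 3 → ℂ) (j : Fin 3) :
    kcross (-k) (fun i => conj (a i)) j = -conj (kcross k a j) := by
  fin_cases j <;>
    simp only [Fin.zero_eta, Fin.mk_one, Fin.reduceFinMk, kcross_zero, kcross_one, kcross_two,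
      Pi.neg_apply, Int.cast_neg, map_sub, map_mul, map_intCast] <;> ring

/-- **Lagrange's identity with incompressibility**: `Σ_j |(k × a)_j|² = |k|² Σ_j |a_j|²` whenever
`k · a = 0`. [folklore] -/
theorem normSq_kcross_sum (k : Fin 3 → ℤ) (a : Fin 3 → ℂ) (hdiv : kdot k a = 0) :
    ∑ j, Complex.normSq (kcross k a j) = knormSq k * ∑ j, Complex.normSq (a j) := by
  have hdiv' : ((k 0 : ℤ) : ℂ) * a 0 + ((k 1 : ℤ) : ℂ) * a 1 + ((k 2 : ℤ) : ℂ) * a 2 = 0 := by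
    unfold kdot at hdiv; rwa [Fin.sum_univ_three] at hdiv
  apply Complex.ofReal_injective
  unfold knormSq
  push_cast
  simp only [Fin.sum_univ_three, kcross_zero, kcross_one, kcross_two, Complex.normSq_eq_conj_mul_self,
    map_sub, map_mul, map_intCast]
  linear_combination
    (-(((k 0 : ℤ) : ℂ) * conj (a 0) + ((k 1 : ℤ) : ℂ) * conj (a 1) + ((k 2 : ℤ) : ℂ) * conj (a 2))) * hdiv'

/-- **The vorticity coefficient field** `ω̂(k) = i k × û(k)` of a `FourierVelocity` is again real in
physical space (`ω̂(-k) = conj ω̂(k)`) and divergence-free (`k · ω̂(k) = 0`), hence a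
`FourierVelocity`. [folklore] -/
def curl : FourierVelocity where
  coeff k j := I * kcross k (U.coeff k) j
  reality k i := by
    have hU : U.coeff (-k) = fun j => conj (U.coeff k j) := funext fun j => U.reality k j
    rw [hU, kcross_neg_conj, map_mul, Complex.conj_I]
    ring
  divFree k := by
    have h := kdot_kcross k (U.coeff k)
    unfold kdot at h
    calc ∑ i, ((k i : ℤ) : ℂ) * (I * kcross k (U.coeff k) i)
        = I * ∑ i, ((k i : ℤ) : ℂ) * kcross k (U.coeff k) i := by
          rw [Finset.mul_sum]
          exact Finset.sum_congr rfl fun i _ => by ring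
      _ = 0 := by rw [h, mul_zero]

/-- `(curl û)(k)_j = i (k × û(k))_j`. [folklore] -/
@[simp] theorem curl_coeff (k : Fin 3 → ℤ) (j : Fin 3) :
    (curl U).coeff k j = I * kcross k (U.coeff k) j := rfl

/-- **Modal enstrophy = modal energy of the vorticity**: `½|ω̂(k)|² = |k|² · ½|û(k)|²`
(Lagrange's identity + `k·û(k) = 0`). [folklore] -/
theorem modalEnergy_curl (k : Fin 3 → ℤ) : modalEnergy (curl U) k = knormSq k * modalEnergy U k := by
  unfold modalEnergy
  have h : ∑ j, Complex.normSq ((curl U).coeff k j) = ∑ j, Complex.normSq (kcross k (U.coeff k) j) := by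
    refine Finset.sum_congr rfl fun j _ => ?_
    rw [curl_coeff, Complex.normSq_mul, Complex.normSq_I, one_mul]
  rw [h, normSq_kcross_sum k (U.coeff k) (U.divFree k)]
  ring

/-- **`E_S(curl û) = Z_S(û)`**: the truncated energy of the vorticity field is the truncated
enstrophy. [folklore] -/
theorem truncEnergy_curl (S : Finset (Fin 3 → ℤ)) : truncEnergy (curl U) S = truncEnstrophy U S := by
  unfold truncEnergy truncEnstrophy
  exact Finset.sum_congr rfl fun k _ => modalEnergy_curl U k

/-- The physical vorticity components are the curls of the physical velocity components:
`ω_{S,0} = ∂_y u_2 − ∂_z u_1`. [folklore] -/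
theorem field_curl_zero (S : Finset (Fin 3 → ℤ)) (x y z : ℝ) :
    field (curl U) S 0 x y z = dfield U S 1 2 x y z - dfield U S 2 1 x y z := by
  unfold field dfield
  rw [← Finset.sum_sub_distrib]
  refine Finset.sum_congr rfl fun k _ => ?_
  rw [curl_coeff, kcross_zero]
  ring

/-- `ω_{S,1} = ∂_z u_0 − ∂_x u_2`. [folklore] -/
theorem field_curl_one (S : Finset (Fin 3 → ℤ)) (x y z : ℝ) :
    field (curl U) S 1 x y z = dfield U S 2 0 x y z - dfield U S 0 2 x y z := by
  unfold field dfield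
  rw [← Finset.sum_sub_distrib]
  refine Finset.sum_congr rfl fun k _ => ?_
  rw [curl_coeff, kcross_one]
  ring

/-- `ω_{S,2} = ∂_x u_1 − ∂_y u_0`. [folklore] -/
theorem field_curl_two (S : Finset (Fin 3 → ℤ)) (x y z : ℝ) :
    field (curl U) S 2 x y z = dfield U S 0 1 x y z - dfield U S 1 0 x y z := by
  unfold field dfield
  rw [← Finset.sum_sub_distrib]
  refine Finset.sum_congr rfl fun k _ => ?_
  rw [curl_coeff, kcross_two]
  ring

/-- Real parts differentiate along with the field: `∂_x Re u_j = Re ∂_x u_j`. [folklore] -/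
theorem hasDerivAt_field_re_x (S : Finset (Fin 3 → ℤ)) (j : Fin 3) (x y z : ℝ) :
    HasDerivAt (fun s => (field U S j s y z).re) (dfield U S 0 j x y z).re x :=
  Complex.reCLM.hasFDerivAt.comp_hasDerivAt x (hasDerivAt_field_x U S j x y z)

/-- `∂_y Re u_j = Re ∂_y u_j`. [folklore] -/
theorem hasDerivAt_field_re_y (S : Finset (Fin 3 → ℤ)) (j : Fin 3) (x y z : ℝ) :
    HasDerivAt (fun s => (field U S j x s z).re) (dfield U S 1 j x y z).re y :=
  Complex.reCLM.hasFDerivAt.comp_hasDerivAt y (hasDerivAt_field_y U S j x y z)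

/-- `∂_z Re u_j = Re ∂_z u_j`. [folklore] -/
theorem hasDerivAt_field_re_z (S : Finset (Fin 3 → ℤ)) (j : Fin 3) (x y z : ℝ) :
    HasDerivAt (fun s => (field U S j x y s).re) (dfield U S 2 j x y z).re z :=
  Complex.reCLM.hasFDerivAt.comp_hasDerivAt z (hasDerivAt_field_z U S j x y z)

/-- **`vorticity₁` of the real velocity fields `Re u_j` is `Re ω_{S,0}`** (ClassicalLatticeData's
coordinate-line curl, evaluated on the trigonometric polynomials). [folklore] -/
theorem vorticity₁_field_re (S : Finset (Fin 3 → ℤ)) (x y z : ℝ) :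
    vorticity₁ (fun x y z => (field U S 0 x y z).re) (fun x y z => (field U S 1 x y z).re)
      (fun x y z => (field U S 2 x y z).re) x y z = (field (curl U) S 0 x y z).re := by
  simp only [vorticity₁]
  rw [(hasDerivAt_field_re_y U S 2 x y z).deriv, (hasDerivAt_field_re_z U S 1 x y z).deriv,
    field_curl_zero, Complex.sub_re]

/-- `vorticity₂ (Re u) = Re ω_{S,1}`. [folklore] -/
theorem vorticity₂_field_re (S : Finset (Fin 3 → ℤ)) (x y z : ℝ) :
    vorticity₂ (fun x y z => (field U S 0 x y z).re) (fun x y z => (field U S 1 x y z).re)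
      (fun x y z => (field U S 2 x y z).re) x y z = (field (curl U) S 1 x y z).re := by
  simp only [vorticity₂]
  rw [(hasDerivAt_field_re_z U S 0 x y z).deriv, (hasDerivAt_field_re_x U S 2 x y z).deriv,
    field_curl_one, Complex.sub_re]

/-- `vorticity₃ (Re u) = Re ω_{S,2}`. [folklore] -/
theorem vorticity₃_field_re (S : Finset (Fin 3 → ℤ)) (x y z : ℝ) :
    vorticity₃ (fun x y z => (field U S 0 x y z).re) (fun x y z => (field U S 1 x y z).re)
      (fun x y z => (field U S 2 x y z).re) x y z = (field (curl U) S 2 x y z).re := by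
  simp only [vorticity₃]
  rw [(hasDerivAt_field_re_x U S 1 x y z).deriv, (hasDerivAt_field_re_y U S 0 x y z).deriv,
    field_curl_two, Complex.sub_re]

/-- **Parseval for the enstrophy, vorticity form.** For every truncated real incompressible field on
a symmetric mode set, ClassicalLatticeData's `cellEnstrophy = ½⟨|ω|²⟩` of the real fields `Re u_j`
equals the spectral `truncEnstrophy û S = ½ Σ_{k∈S} |k|²|û(k)|²`. [folklore] -/
theorem cellEnstrophy_field_eq_truncEnstrophy (S : Finset (Fin 3 → ℤ)) (hK : ∀ k ∈ S, -k ∈ S) :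
    cellEnstrophy (fun x y z => (field U S 0 x y z).re) (fun x y z => (field U S 1 x y z).re)
      (fun x y z => (field U S 2 x y z).re) = truncEnstrophy U S := by
  unfold cellEnstrophy
  have h1 : vorticity₁ (fun x y z => (field U S 0 x y z).re) (fun x y z => (field U S 1 x y z).re)
      (fun x y z => (field U S 2 x y z).re) = fun x y z => (field (curl U) S 0 x y z).re := by
    funext x y z; exact vorticity₁_field_re U S x y z
  have h2 : vorticity₂ (fun x y z => (field U S 0 x y z).re) (fun x y z => (field U S 1 x y z).re)
      (fun x y z => (field U S 2 x y z).re) = fun x y z => (field (curl U) S 1 x y z).re := by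
    funext x y z; exact vorticity₂_field_re U S x y z
  have h3 : vorticity₃ (fun x y z => (field U S 0 x y z).re) (fun x y z => (field U S 1 x y z).re)
      (fun x y z => (field U S 2 x y z).re) = fun x y z => (field (curl U) S 2 x y z).re := by
    funext x y z; exact vorticity₃_field_re U S x y z
  rw [h1, h2, h3, cellEnergy_field_eq_truncEnergy (curl U) S hK, truncEnergy_curl]

/-- **`⟨|ω|²⟩ = ⟨|∇u|²⟩` for truncated divergence-free fields**, in the form the two files use:
`cellEnstrophy (Re u) = (2π)⁻³ Re ∫∫∫ ½ Σ_{l,j} (∂_l u_j)²`. [folklore] -/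
theorem cellEnstrophy_field_eq_half_mean_gradSq (S : Finset (Fin 3 → ℤ)) (hK : ∀ k ∈ S, -k ∈ S) :
    cellEnstrophy (fun x y z => (field U S 0 x y z).re) (fun x y z => (field U S 1 x y z).re)
      (fun x y z => (field U S 2 x y z).re) =
      (cellIntegralC (fun x y z => ∑ l, ∑ j, dfield U S l j x y z * dfield U S l j x y z)).re /
        (2 * π) ^ 3 / 2 := by
  rw [cellEnstrophy_field_eq_truncEnstrophy U S hK, truncEnstrophy_eq_cellMean U S hK]

/-- One level up the same way: `E_S(curl curl û) = Z_S(curl û)` (`½⟨|∇ × ω|²⟩`, the palinstrophy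
of the truncated field, is the enstrophy of its vorticity field). [folklore] -/
theorem truncEnergy_curl_curl (S : Finset (Fin 3 → ℤ)) :
    truncEnergy (curl (curl U)) S = truncEnstrophy (curl U) S :=
  truncEnergy_curl (curl U) S

/-! ## Parseval for the HELICITY and the spectral realizability bound (v3, literature seat gen 15)

`ClassicalLatticeData.cellHelicity = ⟨u · ω⟩` (the third datum number of that file: `H(0) = 0` for
Taylor–Green and Kida–Pelz; `H = A² + B² + C² = 2E` for the ABC datum of ABCFlowData) equals the
spectral helicity `Σ_{k∈S} Re(û(k) · conj ω̂(k))` of the truncated field; and mode by mode the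
helicity is bounded by the energy, `|H(k)| ≤ 2|k| E(k)` (Cauchy–Schwarz with `|ω̂(k)| = |k||û(k)|`
from v2) — the realizability condition of helical turbulence [folklore; Kraichnan 1973, Moffatt
1969; used as `|H(k)| ≤ k E(k)` for the shell spectra normalised per unit wavenumber]. A Beltrami
mode (`ω̂ = ±|k| û`, e.g. every mode of the ABC datum, `|k| = 1`) attains it. -/

variable (V : FourierVelocity)

/-- `Σ_j u_j v_j` for two truncated fields on the same mode set, as one finite sum of plane waves.
[folklore] -/
theorem fieldMul_expand (S : Finset (Fin 3 → ℤ)) (x y z : ℝ) :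
    ∑ j, field U S j x y z * field V S j x y z =
      ∑ t ∈ (Finset.univ : Finset (Fin 3)) ×ˢ (S ×ˢ S),
        (U.coeff t.2.1 t.1 * V.coeff t.2.2 t.1) * wave (t.2.1 + t.2.2) x y z := by
  rw [Finset.sum_product]
  refine Finset.sum_congr rfl fun j _ => ?_
  unfold field
  rw [Finset.sum_mul_sum, Finset.sum_product]
  refine Finset.sum_congr rfl fun k _ => Finset.sum_congr rfl fun p _ => ?_
  rw [wave_add]; ring

/-- `∫∫∫ Σ_j u_j v_j = Σ_j Σ_{k,p∈S} [k+p=0] (2π)³ û_j(k) v̂_j(p)`. [folklore] -/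
theorem cellIntegralC_fieldMul_sum (S : Finset (Fin 3 → ℤ)) :
    cellIntegralC (fun x y z => ∑ j, field U S j x y z * field V S j x y z) =
      ∑ j, ∑ k ∈ S, ∑ p ∈ S,
        if k + p = 0 then U.coeff k j * V.coeff p j * (2 * π : ℂ) ^ 3 else 0 := by
  have e : (fun x y z => ∑ j, field U S j x y z * field V S j x y z) = fun x y z =>
      ∑ t ∈ (Finset.univ : Finset (Fin 3)) ×ˢ (S ×ˢ S),
        (U.coeff t.2.1 t.1 * V.coeff t.2.2 t.1) * wave (t.2.1 + t.2.2) x y z := by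
    funext x y z; exact fieldMul_expand U V S x y z
  rw [e, cellIntegralC_sum_wave]
  simp_rw [modeIntegral_prod_eq]
  rw [Finset.sum_product]
  refine Finset.sum_congr rfl fun j _ => ?_
  rw [Finset.sum_product]
  refine Finset.sum_congr rfl fun k _ => Finset.sum_congr rfl fun p _ => ?_
  split_ifs <;> simp

/-- Closed pairs, bilinear form: `Σ_{p∈S}[k+p=0](2π)³ û_j(k) v̂_j(p) = (2π)³ û_j(k) conj v̂_j(k)`
(`k ∈ S = -S`, reality of `v̂`). [folklore] -/
theorem sum_closedPair_mul (S : Finset (Fin 3 → ℤ)) (hK : ∀ k ∈ S, -k ∈ S) (j : Fin 3)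
    {k : Fin 3 → ℤ} (hk : k ∈ S) :
    (∑ p ∈ S, if k + p = 0 then U.coeff k j * V.coeff p j * (2 * π : ℂ) ^ 3 else 0) =
      (2 * π : ℂ) ^ 3 * (U.coeff k j * conj (V.coeff k j)) := by
  have hiff : ∀ p : Fin 3 → ℤ, (k + p = 0) = (-k = p) := fun p =>
    propext neg_eq_iff_add_eq_zero.symm
  simp_rw [hiff]
  rw [Finset.sum_ite_eq S (-k), if_pos (hK k hk), V.reality]
  ring

/-- **Bilinear Parseval**: `∫∫∫_cell Σ_j u_j v_j = (2π)³ Σ_{k∈S} Σ_j û_j(k) conj v̂_j(k)` for two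
truncated real fields on the same symmetric mode set. [folklore] -/
theorem cellIntegralC_fieldMul (S : Finset (Fin 3 → ℤ)) (hK : ∀ k ∈ S, -k ∈ S) :
    cellIntegralC (fun x y z => ∑ j, field U S j x y z * field V S j x y z) =
      (2 * π : ℂ) ^ 3 * ∑ k ∈ S, ∑ j, U.coeff k j * conj (V.coeff k j) := by
  rw [cellIntegralC_fieldMul_sum]
  have h : ∀ j, ∑ k ∈ S, (∑ p ∈ S, if k + p = 0 then U.coeff k j * V.coeff p j * (2 * π : ℂ) ^ 3 else 0) =
      ∑ k ∈ S, (2 * π : ℂ) ^ 3 * (U.coeff k j * conj (V.coeff k j)) := fun j =>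
    Finset.sum_congr rfl fun k hk => sum_closedPair_mul U V S hK j hk
  simp_rw [h]
  rw [Finset.sum_comm, Finset.mul_sum]
  refine Finset.sum_congr rfl fun k _ => ?_
  rw [Finset.mul_sum]

/-- **Modal helicity** `H(k) = Re(û(k) · conj ω̂(k))`, `ω̂ = ik × û` (the summand of `⟨u·ω⟩` in
Fourier space; real mode by mode up to the `k ↔ -k` pairing, see `modalHelicity_neg`). [folklore] -/
def modalHelicity (k : Fin 3 → ℤ) : ℝ := (∑ j, U.coeff k j * conj ((curl U).coeff k j)).re

/-- Helicity of the truncated system, `H_S = Σ_{k∈S} H(k)`. [folklore] -/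
def truncHelicity (S : Finset (Fin 3 → ℤ)) : ℝ := ∑ k ∈ S, modalHelicity U k

/-- `H(-k) = H(k)` (reality of `û` and `ω̂`). [folklore] -/
theorem modalHelicity_neg (k : Fin 3 → ℤ) : modalHelicity U (-k) = modalHelicity U k := by
  unfold modalHelicity
  have h : ∑ j, U.coeff (-k) j * conj ((curl U).coeff (-k) j) =
      conj (∑ j, U.coeff k j * conj ((curl U).coeff k j)) := by
    rw [map_sum]
    refine Finset.sum_congr rfl fun j _ => ?_
    rw [U.reality, (curl U).reality, map_mul, Complex.conj_conj]
  rw [h, Complex.conj_re]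

/-- **Parseval for the helicity**: ClassicalLatticeData's `cellHelicity = ⟨u·ω⟩` of the real fields
`Re u_j` equals the spectral `truncHelicity û S = Σ_{k∈S} Re(û(k)·conj ω̂(k))`. [folklore] -/
theorem cellHelicity_field_eq_truncHelicity (S : Finset (Fin 3 → ℤ)) (hK : ∀ k ∈ S, -k ∈ S) :
    cellHelicity (fun x y z => (field U S 0 x y z).re) (fun x y z => (field U S 1 x y z).re)
      (fun x y z => (field U S 2 x y z).re) = truncHelicity U S := by
  unfold cellHelicity cellMean
  -- the integrand u·ω of the real fields is Re Σ_j u_j ω_j of the complex representations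
  have e : (fun x y z =>
      (field U S 0 x y z).re * vorticity₁ (fun x y z => (field U S 0 x y z).re)
          (fun x y z => (field U S 1 x y z).re) (fun x y z => (field U S 2 x y z).re) x y z +
        (field U S 1 x y z).re * vorticity₂ (fun x y z => (field U S 0 x y z).re)
          (fun x y z => (field U S 1 x y z).re) (fun x y z => (field U S 2 x y z).re) x y z +
        (field U S 2 x y z).re * vorticity₃ (fun x y z => (field U S 0 x y z).re)
          (fun x y z => (field U S 1 x y z).re) (fun x y z => (field U S 2 x y z).re) x y z) =
      fun x y z => (((∑ j, field U S j x y z * field (curl U) S j x y z).re : ℝ)) := by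
    funext x y z
    rw [vorticity₁_field_re, vorticity₂_field_re, vorticity₃_field_re, Fin.sum_univ_three,
      field_eq_ofReal_re U S hK 0, field_eq_ofReal_re U S hK 1, field_eq_ofReal_re U S hK 2,
      field_eq_ofReal_re (curl U) S hK 0, field_eq_ofReal_re (curl U) S hK 1,
      field_eq_ofReal_re (curl U) S hK 2]
    simp only [Complex.ofReal_re, Complex.add_re, Complex.mul_re, Complex.ofReal_im, mul_zero,
      sub_zero]
  rw [e]
  -- its cell integral is the real part of the complex cell integral, computed by the bilinear Parseval
  have hint : cellIntegral (fun x y z => (∑ j, field U S j x y z * field (curl U) S j x y z).re) =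
      (cellIntegralC (fun x y z => ∑ j, field U S j x y z * field (curl U) S j x y z)).re := by
    have hreal : (fun x y z => ∑ j, field U S j x y z * field (curl U) S j x y z) = fun x y z =>
        ((((∑ j, field U S j x y z * field (curl U) S j x y z).re : ℝ)) : ℂ) := by
      funext x y z
      rw [Fin.sum_univ_three, field_eq_ofReal_re U S hK 0, field_eq_ofReal_re U S hK 1,
        field_eq_ofReal_re U S hK 2, field_eq_ofReal_re (curl U) S hK 0,
        field_eq_ofReal_re (curl U) S hK 1, field_eq_ofReal_re (curl U) S hK 2]
      simp only [Complex.ofReal_re, Complex.ofReal_im, Complex.add_re, Complex.mul_re, mul_zero,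
        sub_zero]
      push_cast
      ring
    conv_rhs => rw [hreal, cellIntegralC_ofReal, Complex.ofReal_re]
  rw [hint, cellIntegralC_fieldMul U (curl U) S hK]
  have hre : ((2 * π : ℂ) ^ 3 * ∑ k ∈ S, ∑ j, U.coeff k j * conj ((curl U).coeff k j)).re =
      (2 * π) ^ 3 * truncHelicity U S := by
    have hpi : ((2 * π : ℂ) ^ 3) = (((2 * π) ^ 3 : ℝ) : ℂ) := by push_cast; ring
    rw [hpi, Complex.re_ofReal_mul, Complex.re_sum]
    rfl
  rw [hre]
  have hpi : (2 * π) ^ 3 ≠ 0 := by positivity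
  field_simp

/-- **Spectral realizability bound**: `|H(k)| ≤ 2|k| E(k)` — Cauchy–Schwarz in `ℂ³` with
`|ω̂(k)|² = |k|²|û(k)|²` (`modalEnergy_curl`). [folklore] -/
theorem abs_modalHelicity_le (k : Fin 3 → ℤ) :
    |modalHelicity U k| ≤ 2 * Real.sqrt (knormSq k) * modalEnergy U k := by
  unfold modalHelicity
  have hE : 0 ≤ modalEnergy U k := modalEnergy_nonneg U k
  have hA : ∑ j, ‖U.coeff k j‖ ^ 2 = 2 * modalEnergy U k := by
    unfold modalEnergy
    simp_rw [Complex.normSq_eq_norm_sq]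
    ring
  have hB : ∑ j, ‖(curl U).coeff k j‖ ^ 2 = knormSq k * (2 * modalEnergy U k) := by
    have h := modalEnergy_curl U k
    unfold modalEnergy at h
    simp_rw [Complex.normSq_eq_norm_sq] at h
    linear_combination 2 * h + knormSq k * hA
  calc |(∑ j, U.coeff k j * conj ((curl U).coeff k j)).re|
      ≤ ‖∑ j, U.coeff k j * conj ((curl U).coeff k j)‖ := Complex.abs_re_le_norm _
    _ ≤ ∑ j, ‖U.coeff k j * conj ((curl U).coeff k j)‖ := norm_sum_le _ _
    _ = ∑ j, ‖U.coeff k j‖ * ‖(curl U).coeff k j‖ := by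
        refine Finset.sum_congr rfl fun j _ => ?_
        rw [norm_mul, Complex.norm_conj]
    _ ≤ Real.sqrt (∑ j, ‖U.coeff k j‖ ^ 2) * Real.sqrt (∑ j, ‖(curl U).coeff k j‖ ^ 2) :=
        Real.sum_mul_le_sqrt_mul_sqrt _ _ _
    _ = 2 * Real.sqrt (knormSq k) * modalEnergy U k := by
        rw [hA, hB, Real.sqrt_mul (knormSq_nonneg k), ← mul_assoc, mul_comm (Real.sqrt _) (Real.sqrt (knormSq k)),
          mul_assoc, Real.mul_self_sqrt (by positivity)]
        ring

/-- Hence `|H_S| ≤ 2 (max_{k∈S} |k|) E_S`-type bounds; the sharp summed form used by the cell: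
`|H_S| ≤ Σ_{k∈S} 2|k| E(k)`. [folklore] -/
theorem abs_truncHelicity_le (S : Finset (Fin 3 → ℤ)) :
    |truncHelicity U S| ≤ ∑ k ∈ S, 2 * Real.sqrt (knormSq k) * modalEnergy U k := by
  unfold truncHelicity
  exact (Finset.abs_sum_le_sum_abs _ _).trans (Finset.sum_le_sum fun k _ => abs_modalHelicity_le U k)

/-! ## (v4) The integrated Schwarz bound `|H_S| ≤ 2 √E_S √Z_S` -/

/-- **`|H_S| ≤ 2 √E_S √Z_S`** for every coefficient field and every finite mode set: sum
`|H(k)| ≤ 2|k|E(k) = 2 √E(k) · √(|k|²E(k))` over `k ∈ S` and apply Cauchy–Schwarz. In physical space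
(by the Parseval identities of this file) this is `|⟨u·ω⟩| ≤ ⟨|u|²⟩^{1/2} ⟨|ω|²⟩^{1/2}`.
[cite: Lesieur1990, Ch. V §6 (V-6-11)–(V-6-13)] -/
theorem abs_truncHelicity_le_sqrt (S : Finset (Fin 3 → ℤ)) :
    |truncHelicity U S| ≤ 2 * Real.sqrt (truncEnergy U S) * Real.sqrt (truncEnstrophy U S) := by
  have h1 := abs_truncHelicity_le U S
  -- rewrite each summand as a product of two square roots
  have h2 : ∑ k ∈ S, 2 * Real.sqrt (knormSq k) * modalEnergy U k =
      2 * ∑ k ∈ S, Real.sqrt (modalEnergy U k) * Real.sqrt (knormSq k * modalEnergy U k) := by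
    rw [Finset.mul_sum]
    refine Finset.sum_congr rfl fun k _ => ?_
    have he := modalEnergy_nonneg U k
    have hs : Real.sqrt (modalEnergy U k) * Real.sqrt (knormSq k * modalEnergy U k) =
        Real.sqrt (knormSq k) * modalEnergy U k := by
      rw [Real.sqrt_mul (knormSq_nonneg k)]
      calc Real.sqrt (modalEnergy U k) * (Real.sqrt (knormSq k) * Real.sqrt (modalEnergy U k))
          = Real.sqrt (knormSq k) * (Real.sqrt (modalEnergy U k) * Real.sqrt (modalEnergy U k)) := by ring
        _ = Real.sqrt (knormSq k) * modalEnergy U k := by rw [Real.mul_self_sqrt he]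
    rw [hs]
    ring
  -- Cauchy–Schwarz over `k ∈ S`
  have h3 := Real.sum_mul_le_sqrt_mul_sqrt S (fun k => Real.sqrt (modalEnergy U k))
    fun k => Real.sqrt (knormSq k * modalEnergy U k)
  have h4 : ∑ k ∈ S, Real.sqrt (modalEnergy U k) ^ 2 = truncEnergy U S := by
    unfold truncEnergy
    exact Finset.sum_congr rfl fun k _ => Real.sq_sqrt (modalEnergy_nonneg U k)
  have h5 : ∑ k ∈ S, Real.sqrt (knormSq k * modalEnergy U k) ^ 2 = truncEnstrophy U S := by
    unfold truncEnstrophy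
    exact Finset.sum_congr rfl fun k _ =>
      Real.sq_sqrt (mul_nonneg (knormSq_nonneg k) (modalEnergy_nonneg U k))
  rw [h4, h5] at h3
  calc |truncHelicity U S| ≤ ∑ k ∈ S, 2 * Real.sqrt (knormSq k) * modalEnergy U k := h1
    _ = 2 * ∑ k ∈ S, Real.sqrt (modalEnergy U k) * Real.sqrt (knormSq k * modalEnergy U k) := h2
    _ ≤ 2 * (Real.sqrt (truncEnergy U S) * Real.sqrt (truncEnstrophy U S)) := by linarith
    _ = 2 * Real.sqrt (truncEnergy U S) * Real.sqrt (truncEnstrophy U S) := by ring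

/-- Squared form: **`H_S² ≤ 4 E_S Z_S`**. [cite: Lesieur1990, Ch. V §6 (V-6-11)–(V-6-13)] -/
theorem truncHelicity_sq_le (S : Finset (Fin 3 → ℤ)) :
    truncHelicity U S ^ 2 ≤ 4 * truncEnergy U S * truncEnstrophy U S := by
  have h := abs_truncHelicity_le_sqrt U S
  have hE : 0 ≤ truncEnergy U S := Finset.sum_nonneg fun k _ => modalEnergy_nonneg U k
  have hZ := truncEnstrophy_nonneg U S
  have h0 : 0 ≤ 2 * Real.sqrt (truncEnergy U S) * Real.sqrt (truncEnstrophy U S) := by positivity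
  have hsq : |truncHelicity U S| ^ 2 ≤ (2 * Real.sqrt (truncEnergy U S) * Real.sqrt (truncEnstrophy U S)) ^ 2 :=
    pow_le_pow_left₀ (abs_nonneg _) h 2
  rw [sq_abs] at hsq
  calc truncHelicity U S ^ 2 ≤ (2 * Real.sqrt (truncEnergy U S) * Real.sqrt (truncEnstrophy U S)) ^ 2 := hsq
    _ = 4 * Real.sqrt (truncEnergy U S) ^ 2 * Real.sqrt (truncEnstrophy U S) ^ 2 := by ring
    _ = 4 * truncEnergy U S * truncEnstrophy U S := by rw [Real.sq_sqrt hE, Real.sq_sqrt hZ]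

/-- On a mask with `|k|² ≤ K²` (`K ≥ 0`): **`|H_S| ≤ 2K E_S`**. [folklore] -/
theorem abs_truncHelicity_le_of_knormSq_le (S : Finset (Fin 3 → ℤ)) {K : ℝ} (hK0 : 0 ≤ K)
    (hK : ∀ k ∈ S, knormSq k ≤ K ^ 2) : |truncHelicity U S| ≤ 2 * K * truncEnergy U S := by
  refine (abs_truncHelicity_le U S).trans ?_
  unfold truncEnergy
  rw [Finset.mul_sum]
  refine Finset.sum_le_sum fun k hk => ?_
  have he := modalEnergy_nonneg U k
  have hs : Real.sqrt (knormSq k) ≤ K := by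
    rw [← Real.sqrt_sq hK0]
    exact Real.sqrt_le_sqrt (hK k hk)
  nlinarith

/-- **The Schwarz bound in physical space, for the truncated real fields**: on a symmetric mode set,
`|cellHelicity| ≤ 2 √cellEnergy · √cellEnstrophy`, i.e. `|⟨u·ω⟩| ≤ 2 √(½⟨|u|²⟩) √(½⟨|ω|²⟩)` — the
row-level realizability check `|H| ≤ 2√(E Z)` (relative helicity `H/(2√(EZ)) ∈ [-1,1]`).
[cite: Lesieur1990, Ch. V §6 (V-6-11)–(V-6-13)] -/
theorem abs_cellHelicity_field_le (S : Finset (Fin 3 → ℤ)) (hK : ∀ k ∈ S, -k ∈ S) :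
    |cellHelicity (fun x y z => (field U S 0 x y z).re) (fun x y z => (field U S 1 x y z).re)
        (fun x y z => (field U S 2 x y z).re)| ≤
      2 * Real.sqrt (cellEnergy (fun x y z => (field U S 0 x y z).re) (fun x y z => (field U S 1 x y z).re)
            (fun x y z => (field U S 2 x y z).re)) *
        Real.sqrt (cellEnstrophy (fun x y z => (field U S 0 x y z).re) (fun x y z => (field U S 1 x y z).re)
            (fun x y z => (field U S 2 x y z).re)) := by
  rw [cellHelicity_field_eq_truncHelicity U S hK, cellEnergy_field_eq_truncEnergy U S hK,
    cellEnstrophy_field_eq_truncEnstrophy U S hK]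
  exact abs_truncHelicity_le_sqrt U S

end ShellTransfer

end Literature.Analysis.FluidPDE.FluidComputer

end
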